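import Summits.Ventures.HSemireg.TensorK3CayleyOguisoSpectrum
/-!
# Venture HSemireg — W3, the tensor K3 `Σ`: THE MULTISECTION INDEX OF A GENUS-ONE PENCIL DIVIDES 6 — KERNEL LEG of
# t-2 g69/g70's ELLPENCILS-INDEX2 / ALLINDICES §0 (T1) and w3-jac-1 g21's W3-JAC-1-GENUS1 (G0)
# (`target-g6/ELLPENCILS-ALLINDICES-t2g70.md`, `widen/W3/W3-JAC-1-GENUS1.md`; reconciliation `target-g6/X2-GENUS1-t2g71.md`),
# filed by t-2 g71 (`target-g6/t2/t2g71_x2genus1/lean/`).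

HONEST FRAMING. Lean index of the computation cell `pub-hsemireg`, TARGET SEAT 2 (structure / second-code lineage), on the
W3 widening line (Jacobian fibres, the tensor K3 `Σ`).  ELEMENTARY INTEGER LATTICE ARITHMETIC ONLY: no surface, no pencil, no
automorphism is constructed here, and nothing in this file says anything about HC, HC_CM, HC_AV, semiregularity or T1-7d.
WHAT THE INTEGERS MEAN (the cell's notes, not formalised): `Λ = (ℤ¹³, gram)` is the lattice of
`TensorK3CayleyOguisoLattice` (the Néron–Severi lattice of `Σ` under the notes' hypothesis (H)); a genus-one pencil on `Σ` is a
primitive nef isotropic class `f ∈ Λ`, and its MULTISECTION INDEX is the positive generator `d(f)` of the ideal `f·Λ = dℤ`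
(`d = 1` iff the fibration has a section).  Both notes assert `d(f) ∈ {1, 2, 3, 6}` for every primitive isotropic `f`, read off
the isotropic elements of the discriminant form `(A_Λ, q_Λ) ≅ ℤ/24 ⊕ (ℤ/3)³` by machine.  THIS FILE PROVES THAT STATEMENT IN THE
KERNEL FOR ALL `f : Fin 13 → ℤ` (not by enumeration): with `E := 24·gram⁻¹` (an integer matrix: the exponent of `A_Λ` divides 24),
(1) `gram * E = 24·1 = E * gram`; (2) THE 2-ADIC LEMMA: `E ≡ 3·w wᵀ (mod 8)` for the explicit `w = (2,3,0,0,0,0,0,5,5,5,5,5,5)`,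
hence for every `m : Fin 13 → ℤ` with `8 ∣ mᵀ E m` one has `4 ∣ E m` (in lattice words: a dual vector `y = E m/24 ∈ Λ^∨` whose
norm has no 2-adic pole, `q(y) ∈ ⅓ℤ`, satisfies `6y ∈ Λ` — «no isotropic element of `A_Λ` has order divisible by 4»);
(3) THE INDEX THEOREM: if `f ⬝ᵥ gram f = 0` and `d ∣ gram f` coordinatewise then `d ∣ 6·f` coordinatewise
(`divisor_dvd_six_mul`), so for PRIMITIVE `f` (a Bézout witness `c ⬝ᵥ f = 1`, equivalent to `gcd = 1` over ℤ) every common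
divisor of the pairings `f·Λ` divides 6 (`pencil_index_dvd_six`) — i.e. `d(f) ∣ 6`; (4) each of `d = 1, 2, 3, 6` OCCURS: the
explicit primitive isotropic classes `f₁ = h₊ − V₁ − H₁` (a Jacobian pencil of the minimal degree 8), `f₂ = 2h₊ − h₋ − 2V₁ − H₁ + Σ_{j≠1} H_j`
(degree 12), `f₃ = 3h₋ − (V₁+V₂+V₃) − 2(H₁+H₂+H₃)` (degree 21), `f₆ = 3h₋ + 2(V₄+V₅+V₆) − 3(H₁+H₂+H₃) + (H₄+H₅+H₆)` (degree 30)
— the minimal pencils of W3-JAC-1-GENUS1 (G7) / t-2 g71 `pencils.py` — have `f·Λ = dℤ` with `d = 1, 2, 3, 6` respectively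
(divisibility + a Bézout combination, `decide`), and pair to `≥ 0` with the twelve lines `V_i, H_j`.
NOT proved here (and not claimed): nefness of `f₂, f₃, f₆` (it needs the census of roots of degree `< 6, 7, 5`, done twice by
machine: jac-1 `minimal_pencils.py`, t-2 g71 `pencils.py`), the class numbers `49 / 9 / 14 / 4` of the frame genera, the counts
`4 065 / 137 / 370 / 60`, or anything about `Aut(Σ)`.  Inputs of record: `gram` (part 1).  Data generated by
`target-g6/t2/t2g71_x2genus1/lean/gen_lean.py` from `work/b2/latt.py` (exact rational arithmetic).
-/

namespace Summit.Ventures.HSemireg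

namespace TensorK3PencilIndices

open Matrix hiding gram
open TensorK3CayleyOguisoLattice

/-! ## 1. `E = 24·gram⁻¹` is integral: the exponent of the discriminant group divides 24 -/

/-- `E := 24 · gram⁻¹` (an INTEGER matrix; `= Gadj / 27` of part 2). -/
def E : Matrix (Fin 13) (Fin 13) ℤ := !![-132, 138, 48, 48, 48, 48, 48, -42, -42, -42, -42, -42, -66; 138, -141, -48, -48, -48, -48, -48, 45, 45, 45, 45, 45, 69; 48, -48, -32, -16, -16, -16, -16, 8, 16, 16, 16, 16, 24; 48, -48, -16, -32, -16, -16, -16, 16, 8, 16, 16, 16, 24; 48, -48, -16, -16, -32, -16, -16, 16, 16, 8, 16, 16, 24; 48, -48, -16, -16, -16, -32, -16, 16, 16, 16, 8, 16, 24; 48, -48, -16, -16, -16, -16, -32, 16, 16, 16, 16, 8, 24; -42, 45, 8, 16, 16, 16, 16, -29, -13, -13, -13, -13, -21; -42, 45, 16, 8, 16, 16, 16, -13, -29, -13, -13, -13, -21; -42, 45, 16, 16, 8, 16, 16, -13, -13, -29, -13, -13, -21; -42, 45, 16, 16, 16, 8, 16, -13, -13, -13, -29, -13, -21; -42, 45,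 16, 16, 16, 16, 8, -13, -13, -13, -13, -29, -21; -66, 69, 24, 24, 24, 24, 24, -21, -21, -21, -21, -21, -45]

/-- `gram * E = 24 • 1`. -/
theorem gram_mul_E : TensorK3CayleyOguisoLattice.gram * E = (24 : ℤ) • (1 : Matrix (Fin 13) (Fin 13) ℤ) := by
  rw [← Matrix.mulᵣ_eq]; ext i j; revert i j; decide +kernel

/-- `E * gram = 24 • 1`. -/
theorem E_mul_gram : E * TensorK3CayleyOguisoLattice.gram = (24 : ℤ) • (1 : Matrix (Fin 13) (Fin 13) ℤ) := by
  rw [← Matrix.mulᵣ_eq]; ext i j; revert i j; decide +kernel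

/-- `Gadj = 27 • E` (consistency with part 2's `648·gram⁻¹`). -/
theorem Gadj_eq : Gadj = (27 : ℤ) • E := by
  decide +kernel

/-- EXPONENT 24: every common divisor of the pairings `gram *ᵥ f` divides `24·f` coordinatewise (for any `f`, isotropic or
not) — `24·Λ^∨ ⊆ Λ`. -/
theorem divisor_dvd_24_mul (f : Fin 13 → ℤ) (d : ℤ) (hd : ∀ i, d ∣ (TensorK3CayleyOguisoLattice.gram *ᵥ f) i) (i : Fin 13) :
    d ∣ 24 * f i := by
  have h24 : E *ᵥ (TensorK3CayleyOguisoLattice.gram *ᵥ f) = (24 : ℤ) • f := by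
    rw [Matrix.mulVec_mulVec, E_mul_gram, Matrix.smul_mulVec, Matrix.one_mulVec]
  have hi := congrFun h24 i
  simp only [Pi.smul_apply, smul_eq_mul] at hi
  rw [← hi]
  show d ∣ ∑ j, E i j * (TensorK3CayleyOguisoLattice.gram *ᵥ f) j
  exact Finset.dvd_sum fun j _ => Dvd.dvd.mul_left (hd j) _

/-- The exponent is not 12: the entry `E 1 1 = −141` is odd, so `12·gram⁻¹ = E/2` is NOT integral. -/
theorem E_one_one_odd : E 1 1 = -141 ∧ ¬ (2 : ℤ) ∣ E 1 1 := by
  refine ⟨by decide, by decide⟩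

/-! ## 2. The 2-adic lemma: `E ≡ 3 · w wᵀ (mod 8)` -/

/-- `w = E e₁ mod 8 = (2,3,0,0,0,0,0,5,5,5,5,5,5)`. -/
def w8 : Fin 13 → ZMod 8 := ![2, 3, 0, 0, 0, 0, 0, 5, 5, 5, 5, 5, 5]

/-- `E mod 8 = 3 · w wᵀ` (rank one; `3 = (E 1 1)⁻¹ mod 8`). -/
theorem E_mod8 : E.map (Int.castRingHom (ZMod 8)) = (3 : ZMod 8) • Matrix.vecMulVec w8 w8 := by
  decide +kernel

/-- `(w wᵀ) x = (w ⬝ᵥ x) · w`. -/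
theorem vecMulVec_mulVec_apply (w x : Fin 13 → ZMod 8) (j : Fin 13) :
    (Matrix.vecMulVec w w *ᵥ x) j = w j * (w ⬝ᵥ x) := by
  simp [Matrix.mulVec, dotProduct, Matrix.vecMulVec_apply, Finset.mul_sum, mul_assoc]

/-- The finite heart: in `ℤ/8`, `3β² = 0` forces `3xβ ∈ {0, 4}` for every `x`. -/
theorem zmod8_aux : ∀ β x : ZMod 8, 3 * β * β = 0 → (3 * x * β = 0 ∨ 3 * x * β = 4) := by
  decide

/-- THE 2-ADIC LEMMA. If `8 ∣ mᵀ E m` then `4 ∣ E m` coordinatewise.  (Lattice reading: `y = E m / 24` runs over `Λ^∨`;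
`q(y) = mᵀ E m / 24`; so `q(y) ∈ ⅓ℤ ⟹ 6y ∈ Λ`: no element of `A_Λ` of order `4, 8, 12, 24` is isotropic, not even 2-adically.) -/
theorem four_dvd_E_mulVec (m : Fin 13 → ℤ) (h : (8 : ℤ) ∣ m ⬝ᵥ (E *ᵥ m)) (i : Fin 13) : (4 : ℤ) ∣ (E *ᵥ m) i := by
  set φ := Int.castRingHom (ZMod 8) with hφ
  set β : ZMod 8 := w8 ⬝ᵥ (φ ∘ m) with hβ
  have hmv : ∀ j, φ ((E *ᵥ m) j) = 3 * w8 j * β := by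
    intro j
    rw [RingHom.map_mulVec, E_mod8, Matrix.smul_mulVec, Pi.smul_apply, vecMulVec_mulVec_apply, smul_eq_mul,
      mul_assoc]
  have hq : φ (m ⬝ᵥ (E *ᵥ m)) = 3 * β * β := by
    have hfun : φ ∘ (E *ᵥ m) = fun j => (3 * β) * w8 j := by
      funext j; simp only [Function.comp_apply, hmv j]; ring
    rw [RingHom.map_dotProduct, hfun]
    have : (fun j => (3 * β) * w8 j) = (3 * β) • w8 := by funext j; simp [smul_eq_mul]
    rw [this, dotProduct_smul, smul_eq_mul, dotProduct_comm, ← hβ]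
  have h0 : φ (m ⬝ᵥ (E *ᵥ m)) = 0 := by
    rw [hφ, Int.coe_castRingHom]; exact (ZMod.intCast_zmod_eq_zero_iff_dvd _ 8).mpr h
  have hββ : 3 * β * β = 0 := by rw [← hq, h0]
  have hi : (((E *ᵥ m) i : ℤ) : ZMod 8) = 3 * w8 i * β := hmv i
  rcases zmod8_aux β (w8 i) hββ with hc | hc
  · rw [hc] at hi
    have h8 : (8 : ℤ) ∣ (E *ᵥ m) i := (ZMod.intCast_zmod_eq_zero_iff_dvd _ 8).mp hi
    exact dvd_trans ⟨2, by norm_num⟩ h8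
  · rw [hc] at hi
    have hsub : (((E *ᵥ m) i - 4 : ℤ) : ZMod 8) = 0 := by simp [hi]
    have h8 : (8 : ℤ) ∣ (E *ᵥ m) i - 4 := (ZMod.intCast_zmod_eq_zero_iff_dvd _ 8).mp hsub
    obtain ⟨k, hk⟩ := h8
    exact ⟨2 * k + 1, by omega⟩

/-! ## 3. The index theorem: for isotropic `f`, every common divisor of `f·Λ` divides `6·f`; for primitive isotropic `f` it divides 6 -/

/-- ISOTROPIC ⟹ `d ∣ gram f ⟹ d ∣ 6 f`.  (No primitivity needed in this form.) -/
theorem divisor_dvd_six_mul (f : Fin 13 → ℤ) (hiso : ip f f = 0) (d : ℤ)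
    (hd : ∀ i, d ∣ (TensorK3CayleyOguisoLattice.gram *ᵥ f) i) (i : Fin 13) : d ∣ 6 * f i := by
  have h24 : E *ᵥ (TensorK3CayleyOguisoLattice.gram *ᵥ f) = (24 : ℤ) • f := by
    rw [Matrix.mulVec_mulVec, E_mul_gram, Matrix.smul_mulVec, Matrix.one_mulVec]
  by_cases hd0 : d = 0
  · subst hd0
    have hz : TensorK3CayleyOguisoLattice.gram *ᵥ f = 0 := by
      funext j; simpa using hd j
    rw [hz, Matrix.mulVec_zero] at h24
    have hf : f i = 0 := by
      have := congrFun h24 i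
      simp only [Pi.zero_apply, Pi.smul_apply, smul_eq_mul] at this
      omega
    simp [hf]
  · choose k hk using hd
    have hk' : TensorK3CayleyOguisoLattice.gram *ᵥ f = d • k := by
      funext j; simpa [Pi.smul_apply, smul_eq_mul] using hk j
    -- (1) d • (E k) = 24 • f
    have h1 : d • (E *ᵥ k) = (24 : ℤ) • f := by
      rw [← Matrix.mulVec_smul, ← hk', h24]
    -- (2) kᵀ E k = 0
    have h2' : (d * d) * (k ⬝ᵥ (E *ᵥ k)) = 24 * ip f f := by
      have : (d • k) ⬝ᵥ (E *ᵥ (d • k)) = (d * d) * (k ⬝ᵥ (E *ᵥ k)) := by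
        rw [Matrix.mulVec_smul, smul_dotProduct, dotProduct_smul, smul_eq_mul, smul_eq_mul, mul_assoc]
      rw [← this, ← hk', h24, dotProduct_smul, smul_eq_mul, ip, dotProduct_comm]
    rw [hiso, mul_zero] at h2'
    have h2 : k ⬝ᵥ (E *ᵥ k) = 0 := by
      rcases mul_eq_zero.mp h2' with h | h
      · exact absurd (mul_self_eq_zero.mp h) hd0
      · exact h
    -- (3) the 2-adic lemma
    have h4 : (4 : ℤ) ∣ (E *ᵥ k) i := four_dvd_E_mulVec k (by rw [h2]; exact dvd_zero 8) i
    obtain ⟨t, ht⟩ := h4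
    have hi := congrFun h1 i
    simp only [Pi.smul_apply, smul_eq_mul] at hi
    rw [ht] at hi
    -- hi : d * (4 * t) = 24 * f i
    exact ⟨t, by linarith⟩

/-- THE INDEX THEOREM (G0)/(T1): for a PRIMITIVE isotropic `f ∈ Λ` (primitive = a Bézout combination `c ⬝ᵥ f = 1` exists,
equivalent over ℤ to `gcd(f_i) = 1`), every common divisor `d` of the pairings `f·Λ` (the coordinates of `gram *ᵥ f`) divides 6:
the multisection index `d(f) ∈ {1, 2, 3, 6}`. -/
theorem pencil_index_dvd_six (f : Fin 13 → ℤ) (hiso : ip f f = 0) (hprim : ∃ c : Fin 13 → ℤ, c ⬝ᵥ f = 1) (d : ℤ)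
    (hd : ∀ i, d ∣ (TensorK3CayleyOguisoLattice.gram *ᵥ f) i) : d ∣ 6 := by
  obtain ⟨c, hc⟩ := hprim
  have h6 : (6 : ℤ) = ∑ i, c i * (6 * f i) := by
    have : ∑ i, c i * (6 * f i) = 6 * (c ⬝ᵥ f) := by
      rw [dotProduct, Finset.mul_sum]; exact Finset.sum_congr rfl fun i _ => by ring
    rw [this, hc, mul_one]
  rw [h6]
  exact Finset.dvd_sum fun i _ => Dvd.dvd.mul_left (divisor_dvd_six_mul f hiso d hd i) _

/-! ## 4. Each index `1, 2, 3, 6` occurs: the minimal pencils of (G7) -/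

/-- `f₁ = h₊ − V₁ − H₁` (jac-1's seed «cubic pencil»: a Jacobian pencil of minimal `a`-degree 8). -/
def f1 : Fin 13 → ℤ := ![1, 0, -1, 0, 0, 0, 0, -1, 0, 0, 0, 0, 0]

/-- `f₂ = 2h₊ − h₋ − 2V₁ − H₁ + H₂ + ⋯ + H₆` (index 2, degree 12, frame `5A₂`). -/
def f2 : Fin 13 → ℤ := ![2, -1, -2, 0, 0, 0, 0, -1, 1, 1, 1, 1, 1]

/-- `f₃ = 3h₋ − V₁ − V₂ − V₃ − 2H₁ − 2H₂ − 2H₃` (index 3, degree 21, frame `A₁ + 2A₂ + A₅`). -/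
def f3 : Fin 13 → ℤ := ![0, 3, -1, -1, -1, 0, 0, -2, -2, -2, 0, 0, 0]

/-- `f₆ = 3h₋ + 2(V₄ + V₅ + V₆) − 3(H₁ + H₂ + H₃) + (H₄ + H₅ + H₆)` in `Λ`-coordinates (`V₆` eliminated by (R1); index 6,
degree 30, frame `A₅ + E₆`). -/
def f6 : Fin 13 → ℤ := ![6, -3, -2, -2, -2, 0, 0, -1, -1, -1, 3, 3, 3]

/-- The four classes in the notes' names. -/
theorem witnesses_names : f1 = hplus - V 0 - Hc 0 ∧ f2 = 2 • hplus - hminus - 2 • V 0 - Hc 0 + Hc 1 + Hc 2 + Hc 3 + Hc 4 + Hc 5 ∧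
    f3 = 3 • hminus - V 0 - V 1 - V 2 - 2 • Hc 0 - 2 • Hc 1 - 2 • Hc 2 ∧
    f6 = 3 • hminus + 2 • (V 3 + V 4 + V 5) - 3 • (Hc 0 + Hc 1 + Hc 2) + (Hc 3 + Hc 4 + Hc 5) := by
  refine ⟨?_, ?_, ?_, ?_⟩ <;> decide +kernel

/-- All four are ISOTROPIC and PRIMITIVE (Bézout witnesses), of `a`-degrees `8, 12, 21, 30` (`a = h₊ + h₋`). -/
theorem witnesses_isotropic_primitive :
    ip f1 f1 = 0 ∧ ip f2 f2 = 0 ∧ ip f3 f3 = 0 ∧ ip f6 f6 = 0 ∧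
    (![0, 0, 0, 0, 0, 0, 0, -1, 0, 0, 0, 0, 0] : Fin 13 → ℤ) ⬝ᵥ f1 = 1 ∧ (![0, 0, 0, 0, 0, 0, 0, 0, 0, 0, 0, 0, 1] : Fin 13 → ℤ) ⬝ᵥ f2 = 1 ∧
    (![0, 0, 0, 0, 1, 0, 0, -1, 1, -1, 0, 0, 0] : Fin 13 → ℤ) ⬝ᵥ f3 = 1 ∧ (![0, 0, 0, 0, 0, 0, 0, 0, 0, -1, 0, 0, 0] : Fin 13 → ℤ) ⬝ᵥ f6 = 1 ∧
    ip f1 (hplus + hminus) = 8 ∧ ip f2 (hplus + hminus) = 12 ∧ ip f3 (hplus + hminus) = 21 ∧ ip f6 (hplus + hminus) = 30 := by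
  refine ⟨?_, ?_, ?_, ?_, ?_, ?_, ?_, ?_, ?_, ?_, ?_, ?_⟩ <;> decide +kernel

/-- THE INDICES: `gram *ᵥ f_d` is divisible by `d` coordinatewise and `d` is a ℤ-combination of its coordinates
(so `f_d·Λ = dℤ` exactly), for `d = 1, 2, 3, 6`. -/
theorem witnesses_index :
    ((![0, 0, 0, 0, 0, 0, 0, 0, 0, 0, 0, 0, 1] : Fin 13 → ℤ) ⬝ᵥ (TensorK3CayleyOguisoLattice.gram *ᵥ f1) = 1) ∧
    ((∀ i, (2 : ℤ) ∣ (TensorK3CayleyOguisoLattice.gram *ᵥ f2) i) ∧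
      (![0, 0, 0, 0, 0, 0, 0, 1, 0, 0, 0, 0, 0] : Fin 13 → ℤ) ⬝ᵥ (TensorK3CayleyOguisoLattice.gram *ᵥ f2) = 2) ∧
    ((∀ i, (3 : ℤ) ∣ (TensorK3CayleyOguisoLattice.gram *ᵥ f3) i) ∧
      (![0, 0, 0, 0, 0, 0, 0, 0, 0, 1, 0, 0, 0] : Fin 13 → ℤ) ⬝ᵥ (TensorK3CayleyOguisoLattice.gram *ᵥ f3) = 3) ∧
    ((∀ i, (6 : ℤ) ∣ (TensorK3CayleyOguisoLattice.gram *ᵥ f6) i) ∧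
      (![0, 0, 0, 0, 0, 0, 0, 0, 0, 1, 0, 0, 0] : Fin 13 → ℤ) ⬝ᵥ (TensorK3CayleyOguisoLattice.gram *ᵥ f6) = 6) := by
  refine ⟨?_, ⟨?_, ?_⟩, ⟨?_, ?_⟩, ⟨?_, ?_⟩⟩ <;> decide +kernel

/-- LINE INCIDENCES (the part of nefness that needs no root census): each `f_d` pairs to `≥ 0` with the twelve lines:
`(f·V₁,…,f·V₆ | f·H₁,…,f·H₆)` = `f₁ (1,0,0,0,0,0 | 2,1,1,1,1,1)`, `f₂ (2,0,0,0,0,0 | 2,0,0,0,0,0)`, `f₃ (3,3,3,3,3,3 | 3,3,3,0,0,0)`,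
`f₆ (0,0,0,0,0,0 | 6,6,6,0,0,0)` (jac-1 (G7): for `f₆` nine of the twelve lines are fibre components). -/
theorem witnesses_lines :
    (List.ofFn fun i => ip f1 (V i)) = [1, 0, 0, 0, 0, 0] ∧ (List.ofFn fun i => ip f1 (Hc i)) = [2, 1, 1, 1, 1, 1] ∧
    (List.ofFn fun i => ip f2 (V i)) = [2, 0, 0, 0, 0, 0] ∧ (List.ofFn fun i => ip f2 (Hc i)) = [2, 0, 0, 0, 0, 0] ∧
    (List.ofFn fun i => ip f3 (V i)) = [3, 3, 3, 3, 3, 3] ∧ (List.ofFn fun i => ip f3 (Hc i)) = [3, 3, 3, 0, 0, 0] ∧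
    (List.ofFn fun i => ip f6 (V i)) = [0, 0, 0, 0, 0, 0] ∧ (List.ofFn fun i => ip f6 (Hc i)) = [6, 6, 6, 0, 0, 0] := by
  refine ⟨?_, ?_, ?_, ?_, ?_, ?_, ?_, ?_⟩ <;> decide +kernel

/-- COROLLARY (the index set is EXACTLY the divisors of 6 that occur): `1, 2, 3, 6` occur (above) and, by
`pencil_index_dvd_six`, nothing else can: e.g. no primitive isotropic `f` has all pairings divisible by `4`, `9`, or `12`. -/
theorem no_index_four_nine_twelve (f : Fin 13 → ℤ) (hiso : ip f f = 0) (hprim : ∃ c : Fin 13 → ℤ, c ⬝ᵥ f = 1) :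
    (¬ ∀ i, (4 : ℤ) ∣ (TensorK3CayleyOguisoLattice.gram *ᵥ f) i) ∧ (¬ ∀ i, (9 : ℤ) ∣ (TensorK3CayleyOguisoLattice.gram *ᵥ f) i) ∧
    (¬ ∀ i, (12 : ℤ) ∣ (TensorK3CayleyOguisoLattice.gram *ᵥ f) i) := by
  refine ⟨fun h => ?_, fun h => ?_, fun h => ?_⟩
  · have := pencil_index_dvd_six f hiso hprim 4 h; omega
  · have := pencil_index_dvd_six f hiso hprim 9 h; omega
  · have := pencil_index_dvd_six f hiso hprim 12 h; omega

end TensorK3PencilIndices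

end Summit.Ventures.HSemireg
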